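import Literature.NumberTheory.EllipticCurves.ModularCurve
import HarnessLib

/-!
# Discharge of `Literature.NumberTheory.EllipticCurves.ModularForms.IsNeronLatticeOf.nonsingular` (Silverman AEC VI.3.6(b))

The named fact `Literature.NumberTheory.EllipticCurves.ModularForms.IsNeronLatticeOf.nonsingular` of
`Literature/NumberTheory/EllipticCurves/ModularCurve.lean`: for `L` a Néron lattice of the
elliptic curve `W/ℂ` (`IsNeronLatticeOf W L`, i.e. `g₂(L) = c₄/12`, `g₃(L) = c₆/216`) and
`z ∉ L`, the point `(x, y) = (℘_L(z) − b₂/12, (℘_L'(z) − a₁x − a₃)/2)` is a nonsingular point of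
the affine curve `W`.

Proof, following the source. The first sentence of the proof of Silverman AEC Prop. VI.3.6(b)
("the image of `φ : z ↦ [℘(z), ℘'(z), 1]` is contained in `E(ℂ)`", `E : y² = 4x³ − g₂x − g₃`)
is the differential equation `℘'(z)² = 4℘(z)³ − g₂℘(z) − g₃` (Silverman AEC Thm. VI.3.5(b),
Rem. 3.5.1; Mathlib `PeriodPair.derivWeierstrassP_sq`). Transport along the change of variables
of Silverman AEC III.1: completing the square gives
`4(y² + a₁xy + a₃y) = (2y + a₁x + a₃)² − (a₁x + a₃)²` and
`4(x³ + a₂x² + a₄x + a₆) + (a₁x + a₃)² = 4x³ + b₂x² + 2b₄x + b₆`, and substituting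
`x = ℘ − b₂/12` turns the right-hand side into `4℘³ − (c₄/12)℘ − c₆/216 = 4℘³ − g₂℘ − g₃`; with
`2y + a₁x + a₃ = ℘'` the Weierstrass equation of `W` at `(x, y)` is therefore `¼ ·` the
differential equation (a polynomial identity in `a₁, …, a₆, ℘, ℘'`, checked by
`linear_combination`). Finally every point of a Weierstrass curve with `Δ ≠ 0` is nonsingular
(Silverman AEC Prop. III.1.4(a); Mathlib `WeierstrassCurve.Affine.equation_iff_nonsingular`).

Kept in a sibling file (pure proof, no new definitions); imports only the definitions file.

## References

* J. H. Silverman, *The Arithmetic of Elliptic Curves*, 2nd ed., GTM 106, Springer 2009,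
  Prop. VI.3.6(b) and Thm. VI.3.5(b)/Rem. 3.5.1 (PDF p. 151), III.1 (the `b`- and
  `c`-invariants), Prop. III.1.4(a). [SilvermanAEC2009]
-/

noncomputable section

namespace Literature.NumberTheory.EllipticCurves.ModularForms

/-- **Discharge of `IsNeronLatticeOf.nonsingular`.** For `L` a Néron lattice of the elliptic curve
`W/ℂ` (`g₂(L) = c₄/12`, `g₃(L) = c₆/216`) and `z ∉ L`, the point
`(℘_L(z) − b₂/12, (℘_L'(z) − a₁x − a₃)/2)` lies on `W` — Silverman AEC Prop. VI.3.6(b) (image of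
`z ↦ (℘(z), ℘'(z))` lies on `y² = 4x³ − g₂x − g₃`, i.e. Thm. VI.3.5(b)
`℘'² = 4℘³ − g₂℘ − g₃`, Mathlib `PeriodPair.derivWeierstrassP_sq`) transported along the
completion of the square of III.1 (`x = ℘ − b₂/12`, `2y + a₁x + a₃ = ℘'`) — and is nonsingular
since `Δ(W) ≠ 0` (Prop. III.1.4(a); Mathlib `WeierstrassCurve.Affine.equation_iff_nonsingular`).
[cite: SilvermanAEC2009, Prop. VI.3.6(b)] -/
theorem IsNeronLatticeOf.nonsingular_holds : IsNeronLatticeOf.nonsingular := by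
  intro W _ L hL z hz
  rw [← WeierstrassCurve.Affine.equation_iff_nonsingular, WeierstrassCurve.Affine.equation_iff]
  have h := L.derivWeierstrassP_sq z hz
  rw [hL.1, hL.2] at h
  simp only [WeierstrassCurve.b₂, WeierstrassCurve.b₄, WeierstrassCurve.b₆, WeierstrassCurve.c₄,
    WeierstrassCurve.c₆] at h ⊢
  linear_combination h / 4

end Literature.NumberTheory.EllipticCurves.ModularForms

end
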